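import Summits.Ventures.PercRepro2.CaseOneGadgetUWA1MainIIT
import Summits.Ventures.PercRepro2.CaseOneGadgetUWA1MainIT
import Summits.Ventures.PercRepro2.CaseOneGadgetUWA1Anchor
import Summits.Ventures.PercRepro2.CaseOneGadgetUWOAnchorT

/-!
# The gadget `u ~ {w, a₁}`, `w ~ {u, a₂, o, b}` (uwa1) is an anchor of the six-form calculus
(blind cell PercRepro2, p1 g33; the third four-form gadget anchor gets its six-form twin — the last one)

With `(ii-T)` / `(i-T)` at `u` for the uwa1 gadget (`zSplitIIT_of_gadgetUWA1` / `zSplitIT_of_gadgetUWA1`,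
CaseOneGadgetUWA1MainIIT / MainIT) next to its four forms (`fourForms_of_gadgetUWA1`, CaseOneGadgetUWA1Anchor):
**`sixForms_of_gadgetUWA1`**, **`closedAtT_of_gadgetUWA1`**, **`closedAtT_of_gadgetUWA1Anchor`**. The anchor
set of the six-form calculus grows by `GadgetUWA1Anchor` — the last four-form gadget class outside
`ClosedAnchor` —: `ClosedAnchorTG := ClosedAnchorTO ∨ GadgetUWA1Anchor`
(`= ClosedAnchorTM ∨ GadgetUWOAnchor ∨ GadgetUWA1Anchor`, CaseOneGadgetUWOAnchorT), **`closedAtT_of_closedAnchorTG`**,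
the `a₂`-free residual core `InCoreTG` relative to it (and to its faces, `ClosedAnchorTGF` / `InCoreTGF`) and the
reductions **`closedAtT_of_coreTG`** / **`closedAtT_of_coreTGF`**. With this file every anchor class of the
four-form calculus (`ClosedAnchor`, the two gadgets) is six-form closed. Own code; standard axioms. -/

namespace Summit.Ventures.PercRepro2

namespace CaseOne

universe u

section GadgetUWA1T
variable {V : Type*} {E : Type*} [Fintype E] [DecidableEq E] [Fintype V] [DecidableEq V]
  {R : Type*} [Field R] [LinearOrder R] [IsStrictOrderedRing R]
variable {ends : E → Sym2 V} {o a₁ a₂ b u w : V} {euw eua1 ewa2 ewo ewb : E}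

/-- **The six forms at `u` for the uwa1 gadget**, every finite graph, every weight vector. -/
theorem sixForms_of_gadgetUWA1 (p : E → R) (hp : IsProbVec p)
    (h : IsGadgetUWA1 ends o a₁ a₂ b u w euw eua1 ewa2 ewo ewb) : SixForms p ends o a₁ a₂ u b := by
  obtain ⟨k1, k2, k3, k4⟩ := fourForms_of_gadgetUWA1 p hp h
  exact ⟨k1, k2, zSplitIIT_of_gadgetUWA1 p hp h, k3, k4, zSplitIT_of_gadgetUWA1 p hp h⟩

/-- **The uwa1 gadget is an anchor of the six-form calculus.** -/
theorem closedAtT_of_gadgetUWA1 (h : IsGadgetUWA1 ends o a₁ a₂ b u w euw eua1 ewa2 ewo ewb) :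
    ClosedAtT (R := R) o a₁ a₂ b E ends u :=
  fun p hp => sixForms_of_gadgetUWA1 p hp h

end GadgetUWA1T

section AnchorsTG
variable {V : Type*}

/-- **The anchors of the six-form calculus with both gadgets**: `ClosedAnchorTO` (`= ClosedAnchorTM` or a
uwo-gadget anchor) or a uwa1-gadget anchor. -/
def ClosedAnchorTG (o a₁ a₂ b : V) (E : Type u) (ends : E → Sym2 V) (v : V) : Prop :=
  ClosedAnchorTO o a₁ a₂ b E ends v ∨ GadgetUWA1Anchor o a₁ a₂ b E ends v

variable (o a₁ a₂ b : V) [Fintype V] [DecidableEq V] {R : Type*} [Field R] [LinearOrder R]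
  [IsStrictOrderedRing R]

/-- **A uwa1-gadget anchor is six-form closed.** -/
theorem closedAtT_of_gadgetUWA1Anchor (E : Type u) [Fintype E] [DecidableEq E] (ends : E → Sym2 V)
    (v : V) (h : GadgetUWA1Anchor o a₁ a₂ b E ends v) : ClosedAtT (R := R) o a₁ a₂ b E ends v := by
  obtain ⟨w, euw, eua1, ewa2, ewo, ewb, h⟩ := h
  exact closedAtT_of_gadgetUWA1 h

/-- **A `ClosedAnchorTG` anchor is six-form closed.** -/
theorem closedAtT_of_closedAnchorTG (E : Type u) [Fintype E] [DecidableEq E] (ends : E → Sym2 V)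
    (v : V) (h : ClosedAnchorTG o a₁ a₂ b E ends v) : ClosedAtT (R := R) o a₁ a₂ b E ends v := by
  rcases h with h | h
  · exact closedAtT_of_closedAnchorTO o a₁ a₂ b E ends v h
  · exact closedAtT_of_gadgetUWA1Anchor o a₁ a₂ b E ends v h

variable (v : V)

/-- **The `a₂`-free residual core relative to `ClosedAnchorTG`.** -/
def InCoreTG (E : Type u) [Fintype E] [DecidableEq E] (ends : E → Sym2 V) : Prop :=
  InCoreTAnc o a₁ a₂ b v (fun E₀ _ _ ends₀ v₀ => ClosedAnchorTG o a₁ a₂ b E₀ ends₀ v₀) E ends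

/-- **The reduction to the `a₂`-free residual core with both gadgets among the anchors.** -/
theorem closedAtT_of_coreTG
    (hcore : ∀ (E' : Type u) [Fintype E'] [DecidableEq E'] (ends' : E' → Sym2 V),
      InCoreTG o a₁ a₂ b v E' ends' → ClosedAtT (R := R) o a₁ a₂ b E' ends' v) :
    ∀ (E : Type u) [Fintype E] [DecidableEq E] (ends : E → Sym2 V),
      ClosedAtT (R := R) o a₁ a₂ b E ends v :=
  closedAtT_of_coreTAnc o a₁ a₂ b v _
    (fun E₀ _ _ ends₀ v₀ h => closedAtT_of_closedAnchorTG o a₁ a₂ b E₀ ends₀ v₀ h) hcore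

/-- **The anchors with both gadgets and all their faces.** -/
def ClosedAnchorTGF (E : Type u) [Fintype E] [DecidableEq E] (ends : E → Sym2 V) (v : V) : Prop :=
  ∃ n : ℕ, FaceAnchorN (fun E₀ _ _ ends₀ v₀ => ClosedAnchorTG o a₁ a₂ b E₀ ends₀ v₀) n E ends v

/-- **A `ClosedAnchorTGF` anchor is six-form closed.** -/
theorem closedAtT_of_closedAnchorTGF (E : Type u) [Fintype E] [DecidableEq E] (ends : E → Sym2 V)
    (v : V) (h : ClosedAnchorTGF o a₁ a₂ b E ends v) : ClosedAtT (R := R) o a₁ a₂ b E ends v := by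
  obtain ⟨n, hn⟩ := h
  exact closedAtT_of_faceAnchorN o a₁ a₂ b _
    (fun E₀ _ _ ends₀ v₀ h₀ => closedAtT_of_closedAnchorTG o a₁ a₂ b E₀ ends₀ v₀ h₀) n E ends v hn

/-- **The `a₂`-free residual core relative to the anchors with both gadgets and their faces.** -/
def InCoreTGF (E : Type u) [Fintype E] [DecidableEq E] (ends : E → Sym2 V) : Prop :=
  InCoreTAnc o a₁ a₂ b v (fun E₀ _ _ ends₀ v₀ => ClosedAnchorTGF o a₁ a₂ b E₀ ends₀ v₀) E ends

/-- **The reduction to `InCoreTGF`.** -/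
theorem closedAtT_of_coreTGF
    (hcore : ∀ (E' : Type u) [Fintype E'] [DecidableEq E'] (ends' : E' → Sym2 V),
      InCoreTGF o a₁ a₂ b v E' ends' → ClosedAtT (R := R) o a₁ a₂ b E' ends' v) :
    ∀ (E : Type u) [Fintype E] [DecidableEq E] (ends : E → Sym2 V),
      ClosedAtT (R := R) o a₁ a₂ b E ends v :=
  closedAtT_of_coreTAnc o a₁ a₂ b v _
    (fun E₀ _ _ ends₀ v₀ h => closedAtT_of_closedAnchorTGF o a₁ a₂ b E₀ ends₀ v₀ h) hcore

end AnchorsTG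

end CaseOne

end Summit.Ventures.PercRepro2
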